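import Summits.Ventures.HodgeRepro.Night3GSetKunnethOther
import Summits.Ventures.HodgeRepro.Night3LemmaPCore
import Summits.Ventures.HodgeRepro.Night3GSetForm

/-!
# The correspondence of Lemma P step (2) in coordinates: `contract (Q(·, y)) ∘ κ = ∫_{B_N} ((·) ∧ pr_N^*(y ∧ Λ))`

Blind re-derivation cell `pub-hodge-repro`, seat `night-3` (gen 5, row 2; NIGHT3.md §12).  Imports gen 4's
`Night3GSetKunnethOther` (the lex wedge basis in every degree, the cross product in coordinates, the Künneth projection
`kun`) and this gen's `Night3GSetForm` (the concrete form `Qc = ∫ x ∧ y ∧ Λ`, Weil's class `Λc`).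
Namespace `HodgeRepro.Night3.GSetModel`.

Gen 4's Weil model takes `hproj : ((Alg (M + N)).map (κ M N)).map (LemmaP.contract ((Q N).flip y)) ≤ Alg M` (`y` algebraic)
as a hypothesis — the linear-algebra form of the route's correspondence `Φ_y(ξ) = pr_{M*}(ξ ∪ pr_N^*(y ∪ Λ_N))`.  This
file proves that, on the wedge model with the concrete form, the model's map IS that correspondence:

* `fibInt n k d : ⋀^{n+d} ℂ^{Fin (n+k) × G} →ₗ ⋀^n ℂ^{Fin n × G}` — integration over the second factor (the
  push-forward `pr_{M*}`) in coordinates: `e_S ↦ e_{block₁ S}` if `|block₁ S| = n` (then block 2 of `S` is everything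
  when `d` is the top degree of the second factor), else `0`;
* `fibInt_of_coe_eq_mul_top` / `fibInt_of_coe_eq_mul_of_ne`: `fibInt (pr_M^* e_{T₁} ∧ pr_N^* w) = (∫_{B_N} w) · e_{T₁}`
  for an `n`-set `T₁` and `w` of top degree, and `= 0` when `|T₁| ≠ n`;
* **`contract_kun_eq_fibInt`**: for every `ξ ∈ H^{n+k}(B_M × B_N)`, `y ∈ H^k(B_N)` and `Λ = Λc` of `k` factors,
  `LemmaP.contract ((Qc hc hΦ a).flip y) (kun n k ξ) = fibInt n k D ⟨ξ ∧ pr_N^*(y ∧ Λ), _⟩`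
  (`D = k + (k + 2(m−1)k) = k·|G|`).

READING: `hproj` says «the correspondence with kernel `pr_N^*(y ∪ Λ_N)` — `y` algebraic, `Λ_N` a product of divisor
classes — maps algebraic classes to algebraic classes»: the printed fact that correspondences with algebraic kernels
preserve algebraic classes (Fulton, Intersection Theory, Ch. 16; Kleiman, Algebraic cycles and the Weil conjectures §1)
together with Lefschetz (1,1) for the `L_i`.  The identification of the wedge model with `H^•(B, ℂ)` (cup product = `∧`,
`∫` = the top coordinate) is the printed structure of the cohomology of an abelian variety, stated here, not modelled.
`hproj` stays a hypothesis about the abstract `Alg`.  Nothing here closes S4; nothing here says anything about the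
status of the Hodge conjecture for CM abelian varieties, which is NOT proved.
-/

set_option autoImplicit false
open Finset Module Function
open scoped Pointwise IsMulCommutative
namespace HodgeRepro.Night3.GSetModel

open HodgeRepro.CMHodgeOn ExteriorAlgebra

/-! ### Generalities: `map f` preserves the degree; a set is the union of its blocks -/

section Gen

variable {R : Type*} [CommRing R] {M N : Type*} [AddCommGroup M] [Module R M] [AddCommGroup N] [Module R N]

/-- `ExteriorAlgebra.map f` carries `⋀^d M` into `⋀^d N`. -/
theorem map_mem_exteriorPower (f : M →ₗ[R] N) {d : ℕ} {x : ExteriorAlgebra R M} (hx : x ∈ ⋀[R]^d M) :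
    ExteriorAlgebra.map f x ∈ ⋀[R]^d N := by
  rw [← ιMulti_span_fixedDegree] at hx
  induction hx using Submodule.span_induction with
  | mem x hx =>
    obtain ⟨v, rfl⟩ := hx
    rw [ExteriorAlgebra.map_apply_ιMulti]
    exact ιMulti_range R d ⟨_, rfl⟩
  | zero => rw [map_zero]; exact Submodule.zero_mem _
  | add x y _ _ hx hy => rw [map_add]; exact Submodule.add_mem _ hx hy
  | smul a x _ hx => rw [map_smul]; exact Submodule.smul_mem _ _ hx

end Gen

section Blocks

variable {G : Type*} [Fintype G] [DecidableEq G]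

/-- A set of indices is the union of its two blocks. -/
theorem blocksUnion_block₁_block₂ (n k : ℕ) (S : Finset (Lex (Fin (n + k) × G))) :
    blocksUnion n k (block₁ n k S) (block₂ n k S) = S := by
  ext z
  rw [mem_blocksUnion]
  constructor
  · rintro (⟨x, hx, rfl⟩ | ⟨y, hy, rfl⟩)
    · exact (mem_block₁ n k S x).mp hx
    · exact (mem_block₂ n k S y).mp hy
  · intro hz
    rcases exists_inlEmb_or_inrEmb n k z with ⟨x, rfl⟩ | ⟨y, rfl⟩
    · exact Or.inl ⟨x, (mem_block₁ n k S x).mpr hz, rfl⟩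
    · exact Or.inr ⟨y, (mem_block₂ n k S y).mpr hz, rfl⟩

/-- The blocks of an `(n + k)`-set have `n + k` elements in all. -/
theorem card_block₁_add_card_block₂ (n k : ℕ) (S : Set.powersetCard (Lex (Fin (n + k) × G)) (n + k)) :
    (block₁ n k (S : Finset (Lex (Fin (n + k) × G)))).card +
      (block₂ n k (S : Finset (Lex (Fin (n + k) × G)))).card = n + k := by
  rw [← card_blocksUnion, blocksUnion_block₁_block₂, Set.powersetCard.card_eq]

end Blocks

/-! ### Integration over the second factor -/

section FibInt

variable {G : Type*} [Fintype G] [DecidableEq G] [LinearOrder G]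

/-- **Integration over the second factor** (`pr_{M*}` in coordinates): on the lex wedge basis of `⋀^{n+d}`,
`e_S ↦ e_{block₁ S}` if `|block₁ S| = n`, else `0`. -/
noncomputable def fibInt (n k d : ℕ) : ⋀[ℂ]^(n + d) (V G (n + k)) →ₗ[ℂ] Hn G n :=
  (wedgeBasisD (n + k) (n + d)).constr ℂ fun S =>
    if h : (block₁ n k (S : Finset (Lex (Fin (n + k) × G)))).card = n then wedgeBasis n (toPC _ h) else 0

/-- `fibInt` on a basis vector. -/
theorem fibInt_wedgeBasisD (n k d : ℕ) (S : Set.powersetCard (Lex (Fin (n + k) × G)) (n + d)) :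
    fibInt n k d (wedgeBasisD (n + k) (n + d) S) =
      if h : (block₁ n k (S : Finset (Lex (Fin (n + k) × G)))).card = n then wedgeBasis n (toPC _ h) else 0 := by
  rw [fibInt, Basis.constr_basis]

/-- The union of an `i`-set of block 1 and a `j`-set of block 2 as an `(n + d)`-set (`i + j = n + d`). -/
def blocksUnionPCD' (n k i j d : ℕ) (hij : i + j = n + d) (T₁ : Set.powersetCard (Lex (Fin n × G)) i)
    (T₂ : Set.powersetCard (Lex (Fin k × G)) j) : Set.powersetCard (Lex (Fin (n + k) × G)) (n + d) :=
  toPC (blocksUnion n k T₁ T₂) (by rw [card_blocksUnion, Set.powersetCard.card_eq, Set.powersetCard.card_eq, hij])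

/-- The cross product of two basis vectors is the basis vector of the union, read in degree `n + d`. -/
theorem coe_wedgeBasisD_blocksUnionPCD' (n k i j d : ℕ) (hij : i + j = n + d)
    (T₁ : Set.powersetCard (Lex (Fin n × G)) i) (T₂ : Set.powersetCard (Lex (Fin k × G)) j) :
    (wedgeBasisD (n + k) (n + d) (blocksUnionPCD' n k i j d hij T₁ T₂) : ExteriorAlgebra ℂ (V G (n + k))) =
      ExteriorAlgebra.map (inlMap n k) (wedgeBasisD n i T₁) * ExteriorAlgebra.map (inrMap n k) (wedgeBasisD k j T₂) := by
  rw [← coe_wedgeBasisD_blocksUnionPCD]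
  exact coe_wedgeBasisD_cast (n + k) hij.symm _ _ rfl

/-- `fibInt` of the cross product of two basis vectors. -/
theorem fibInt_blocksUnionPCD' (n k i j d : ℕ) (hij : i + j = n + d) (T₁ : Set.powersetCard (Lex (Fin n × G)) i)
    (T₂ : Set.powersetCard (Lex (Fin k × G)) j) :
    fibInt n k d (wedgeBasisD (n + k) (n + d) (blocksUnionPCD' n k i j d hij T₁ T₂)) =
      if h : i = n then wedgeBasis n (toPC (T₁ : Finset (Lex (Fin n × G))) (by rw [Set.powersetCard.card_eq, h]))
      else 0 := by
  rw [fibInt_wedgeBasisD]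
  simp only [blocksUnionPCD', coe_toPC, block₁_blocksUnion, Set.powersetCard.card_eq]

/-- **The expansion of `fibInt` on a cross product** `pr_M^* e_{T₁} ∧ pr_N^* w`, `w = ∑_T c_T e_T`:
`fibInt z = ∑_T c_T • fibInt (e_{inl T₁ ⊔ inr T})`. -/
theorem fibInt_of_coe_eq_mul (n k i j d : ℕ) (hij : i + j = n + d) (T₁ : Set.powersetCard (Lex (Fin n × G)) i)
    (w : ⋀[ℂ]^j (V G k)) (z : ⋀[ℂ]^(n + d) (V G (n + k)))
    (hz : (z : ExteriorAlgebra ℂ (V G (n + k))) =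
      ExteriorAlgebra.map (inlMap n k) (wedgeBasisD n i T₁) * ExteriorAlgebra.map (inrMap n k) w) :
    fibInt n k d z = ∑ T, (wedgeBasisD k j).repr w T •
      fibInt n k d (wedgeBasisD (n + k) (n + d) (blocksUnionPCD' n k i j d hij T₁ T)) := by
  have hw : w = ∑ T, (wedgeBasisD k j).repr w T • wedgeBasisD k j T := ((wedgeBasisD k j).sum_repr w).symm
  have hz' : z = ∑ T, (wedgeBasisD k j).repr w T • wedgeBasisD (n + k) (n + d) (blocksUnionPCD' n k i j d hij T₁ T) := by
    apply Subtype.ext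
    rw [hz, Submodule.coe_sum]
    conv_lhs => rw [hw]
    rw [Submodule.coe_sum, map_sum, Finset.mul_sum]
    refine Finset.sum_congr rfl fun T _ => ?_
    rw [Submodule.coe_smul, Submodule.coe_smul, map_smul, mul_smul_comm, coe_wedgeBasisD_blocksUnionPCD']
  rw [hz', map_sum]
  simp only [map_smul]

/-- **`fibInt` kills the components whose block-1 degree is not `n`.** -/
theorem fibInt_of_coe_eq_mul_of_ne (n k i j d : ℕ) (hij : i + j = n + d) (hi : i ≠ n)
    (T₁ : Set.powersetCard (Lex (Fin n × G)) i) (w : ⋀[ℂ]^j (V G k)) (z : ⋀[ℂ]^(n + d) (V G (n + k)))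
    (hz : (z : ExteriorAlgebra ℂ (V G (n + k))) =
      ExteriorAlgebra.map (inlMap n k) (wedgeBasisD n i T₁) * ExteriorAlgebra.map (inrMap n k) w) :
    fibInt n k d z = 0 := by
  rw [fibInt_of_coe_eq_mul n k i j d hij T₁ w z hz]
  refine Finset.sum_eq_zero fun T _ => ?_
  rw [fibInt_blocksUnionPCD', dif_neg hi, smul_zero]

omit [DecidableEq G] [LinearOrder G] in
/-- Every `d`-subset of a `d`-element index set is `univ`. -/
theorem eq_univPC {k d : ℕ} (hN : Fintype.card (Lex (Fin k × G)) = d) (T : Set.powersetCard (Lex (Fin k × G)) d) :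
    T = ExtTop.univPC hN := by
  apply Subtype.ext
  show (T : Finset (Lex (Fin k × G))) = univ
  exact Finset.eq_univ_of_card _ (by rw [Set.powersetCard.card_eq, hN])

omit [DecidableEq G] in
/-- The top form of a top-degree basis vector is `1`. -/
theorem ιMultiDual_wedgeBasisD_top {k d : ℕ} (hN : Fintype.card (Lex (Fin k × G)) = d)
    (T : Set.powersetCard (Lex (Fin k × G)) d) :
    exteriorPower.ιMultiDual ℂ d (lexBasis k) (ExtTop.univPC hN) (wedgeBasisD k d T) = 1 := by
  rw [eq_univPC hN T, wedgeBasisD, exteriorPower.coe_basis]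
  exact exteriorPower.ιMultiDual_apply_diag ℂ d (lexBasis k) _

/-- **`fibInt` on the `(n, top)`-component is the integral over the second factor**:
`fibInt (pr_M^* e_{T₁} ∧ pr_N^* w) = (∫_{B_N} w) • e_{T₁}` for an `n`-set `T₁` and `w` of top degree `d`. -/
theorem fibInt_of_coe_eq_mul_top (n k d : ℕ) (hN : Fintype.card (Lex (Fin k × G)) = d)
    (T₁ : Set.powersetCard (Lex (Fin n × G)) n) (w : ⋀[ℂ]^d (V G k)) (z : ⋀[ℂ]^(n + d) (V G (n + k)))
    (hz : (z : ExteriorAlgebra ℂ (V G (n + k))) =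
      ExteriorAlgebra.map (inlMap n k) (wedgeBasis n T₁) * ExteriorAlgebra.map (inrMap n k) w) :
    fibInt n k d z = exteriorPower.ιMultiDual ℂ d (lexBasis k) (ExtTop.univPC hN) w • wedgeBasis n T₁ := by
  rw [fibInt_of_coe_eq_mul n k n d d rfl T₁ w z hz]
  conv_rhs => rw [← (wedgeBasisD k d).sum_repr w]
  rw [map_sum, Finset.sum_smul]
  refine Finset.sum_congr rfl fun T _ => ?_
  rw [fibInt_blocksUnionPCD', dif_pos rfl, map_smul, ιMultiDual_wedgeBasisD_top hN T, smul_eq_mul, mul_one]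
  rfl

end FibInt

/-! ### The correspondence in coordinates -/

section Corr

variable {G : Type*} [Group G] [Fintype G] [DecidableEq G] [LinearOrder G]

/-- The top degree of the second factor in the form's bookkeeping: `k + (k + 2(m−1)k) = k·|G|`. -/
abbrev topDeg (Φ₀ : Finset G) (k : ℕ) : ℕ := k + (k + 2 * (Φ₀.card - 1) * k)

omit [DecidableEq G] [LinearOrder G] in
/-- `y ∧ Λ ∈ ⋀^{k + 2(m−1)k}`. -/
theorem mul_Λc_mem {c : G} {Φ₀ : Finset G} {k : ℕ} (a : Fin k → G → ℂ) (y : Hn G k) :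
    (y : ExteriorAlgebra ℂ (V G k)) * (Λc c Φ₀ a : ExteriorAlgebra ℂ (V G k)) ∈
      ⋀[ℂ]^(k + 2 * (Φ₀.card - 1) * k) (V G k) := by
  rw [exteriorPower, pow_add]
  exact Submodule.mul_mem_mul y.2 (coe_Λc_mem c Φ₀ a)

omit [DecidableEq G] [LinearOrder G] in
/-- `ξ ∧ pr_N^*(y ∧ Λ) ∈ ⋀^{n + D}`. -/
theorem mul_map_mul_Λc_mem {c : G} {Φ₀ : Finset G} {n k : ℕ} (a : Fin k → G → ℂ) (ξ : Hn G (n + k)) (y : Hn G k) :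
    (ξ : ExteriorAlgebra ℂ (V G (n + k))) *
      ExteriorAlgebra.map (inrMap n k) ((y : ExteriorAlgebra ℂ (V G k)) * (Λc c Φ₀ a : ExteriorAlgebra ℂ (V G k))) ∈
      ⋀[ℂ]^(n + topDeg Φ₀ k) (V G (n + k)) := by
  rw [show n + topDeg Φ₀ k = (n + k) + (k + 2 * (Φ₀.card - 1) * k) by unfold topDeg; ring, exteriorPower, pow_add]
  exact Submodule.mul_mem_mul ξ.2 (map_mem_exteriorPower _ (mul_Λc_mem a y))

omit [Group G] [DecidableEq G] in
/-- The top form does not depend on the bookkeeping of the degree. -/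
theorem ιMultiDual_univPC_congr {k d d' : ℕ} (hN : Fintype.card (Lex (Fin k × G)) = d)
    (hN' : Fintype.card (Lex (Fin k × G)) = d') {x x' : ExteriorAlgebra ℂ (V G k)} (hx : x ∈ ⋀[ℂ]^d (V G k))
    (hx' : x' ∈ ⋀[ℂ]^d' (V G k)) (hxx' : x = x') :
    exteriorPower.ιMultiDual ℂ d (lexBasis k) (ExtTop.univPC hN) ⟨x, hx⟩ =
      exteriorPower.ιMultiDual ℂ d' (lexBasis k) (ExtTop.univPC hN') ⟨x', hx'⟩ := by
  subst hxx'
  have hdd : d = d' := hN.symm.trans hN'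
  subst hdd
  rfl

/-- The right-hand side as a linear map: `ξ ↦ ∫_{B_N} (ξ ∧ pr_N^*(y ∧ Λ))`. -/
noncomputable def corrR (c : G) (Φ₀ : Finset G) {k : ℕ} (a : Fin k → G → ℂ) (y : Hn G k) (n : ℕ) :
    Hn G (n + k) →ₗ[ℂ] Hn G n :=
  fibInt n k (topDeg Φ₀ k) ∘ₗ LinearMap.codRestrict (⋀[ℂ]^(n + topDeg Φ₀ k) (V G (n + k)))
    (LinearMap.mulRight ℂ (ExteriorAlgebra.map (inrMap n k)
      ((y : ExteriorAlgebra ℂ (V G k)) * (Λc c Φ₀ a : ExteriorAlgebra ℂ (V G k)))) ∘ₗ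
      (⋀[ℂ]^(n + k) (V G (n + k))).subtype)
    (fun ξ => mul_map_mul_Λc_mem a ξ y)

/-- `corrR` unfolded. -/
theorem corrR_apply (c : G) (Φ₀ : Finset G) {k : ℕ} (a : Fin k → G → ℂ) (y : Hn G k) (n : ℕ) (ξ : Hn G (n + k)) :
    corrR c Φ₀ a y n ξ = fibInt n k (topDeg Φ₀ k) ⟨(ξ : ExteriorAlgebra ℂ (V G (n + k))) *
      ExteriorAlgebra.map (inrMap n k) ((y : ExteriorAlgebra ℂ (V G k)) * (Λc c Φ₀ a : ExteriorAlgebra ℂ (V G k))),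
      mul_map_mul_Λc_mem a ξ y⟩ := rfl

/-- The correspondence in coordinates, on a basis vector of `H^{n+k}(B_M × B_N)`. -/
theorem contract_kun_wedgeBasis_eq_corrR {c : G} (hc : IsComplexConj c) {Φ₀ : Finset G} (hΦ : IsCMType c Φ₀)
    {n k : ℕ} (a : Fin k → G → ℂ) (y : Hn G k) (S : Set.powersetCard (Lex (Fin (n + k) × G)) (n + k)) :
    LemmaP.contract ((Qc hc hΦ a).flip y) (kun n k (wedgeBasis (n + k) S)) =
      corrR c Φ₀ a y n (wedgeBasis (n + k) S) := by
  have hN : Fintype.card (Lex (Fin k × G)) = topDeg Φ₀ k := by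
    rw [card_lex_eq hc hΦ k]; unfold topDeg; ring
  have hS := blocksUnion_block₁_block₂ n k (S : Finset (Lex (Fin (n + k) × G)))
  have hcard := card_block₁_add_card_block₂ n k S
  rw [corrR_apply]
  by_cases hi : (block₁ n k (S : Finset (Lex (Fin (n + k) × G)))).card = n
  · -- the `(n, k)`-component
    have hj : (block₂ n k (S : Finset (Lex (Fin (n + k) × G)))).card = k := by omega
    have hSe : wedgeBasis (n + k) S = wedgeBasis (n + k) (blocksUnionPC n k (toPC _ hi) (toPC _ hj)) := by
      congr 1
      exact Subtype.ext (by rw [blocksUnionPC, coe_toPC, coe_toPC, coe_toPC, hS])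
    rw [hSe, kun_wedgeBasis_blocksUnion, LemmaP.contract_tmul, LinearMap.BilinForm.flip_apply, Qc_apply]
    have hw : (wedgeBasis k (toPC _ hj) : ExteriorAlgebra ℂ (V G k)) *
        ((y : ExteriorAlgebra ℂ (V G k)) * (Λc c Φ₀ a : ExteriorAlgebra ℂ (V G k))) ∈
        ⋀[ℂ]^(topDeg Φ₀ k) (V G k) := by
      rw [topDeg, exteriorPower, pow_add]
      exact Submodule.mul_mem_mul (wedgeBasis k _).2 (mul_Λc_mem a y)
    rw [fibInt_of_coe_eq_mul_top n k (topDeg Φ₀ k) hN (toPC _ hi) ⟨_, hw⟩ _ (by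
      show (wedgeBasis (n + k) (blocksUnionPC n k (toPC _ hi) (toPC _ hj)) : ExteriorAlgebra ℂ (V G (n + k))) *
        _ = _
      rw [coe_wedgeBasis_blocksUnionPC, mul_assoc, ← map_mul])]
    congr 1
    exact ιMultiDual_univPC_congr _ hN _ _ (mul_assoc _ _ _)
  · -- the other Künneth components
    rw [kun_wedgeBasis_of_ne n k S hi, map_zero]
    have hw : (wedgeBasisD k (block₂ n k (S : Finset (Lex (Fin (n + k) × G)))).card ⟨_, rfl⟩ :
        ExteriorAlgebra ℂ (V G k)) *
        ((y : ExteriorAlgebra ℂ (V G k)) * (Λc c Φ₀ a : ExteriorAlgebra ℂ (V G k))) ∈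
        ⋀[ℂ]^((block₂ n k (S : Finset (Lex (Fin (n + k) × G)))).card + (k + 2 * (Φ₀.card - 1) * k)) (V G k) := by
      rw [exteriorPower, pow_add]
      exact Submodule.mul_mem_mul (wedgeBasisD k _ _).2 (mul_Λc_mem a y)
    refine (fibInt_of_coe_eq_mul_of_ne n k _ _ (topDeg Φ₀ k) (by unfold topDeg; omega) hi ⟨_, rfl⟩ ⟨_, hw⟩ _ ?_).symm
    show (wedgeBasis (n + k) S : ExteriorAlgebra ℂ (V G (n + k))) * _ = _
    have hSe : (wedgeBasis (n + k) S : ExteriorAlgebra ℂ (V G (n + k))) =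
        wedgeBasisD (n + k) _ (blocksUnionPCD n k _ _ (⟨_, rfl⟩ : Set.powersetCard (Lex (Fin n × G))
          (block₁ n k (S : Finset (Lex (Fin (n + k) × G)))).card)
          (⟨_, rfl⟩ : Set.powersetCard (Lex (Fin k × G)) (block₂ n k (S : Finset (Lex (Fin (n + k) × G)))).card)) := by
      rw [← wedgeBasisD_eq]
      exact coe_wedgeBasisD_cast (n + k) hcard.symm _ _ (by rw [blocksUnionPCD, coe_toPC, hS])
    rw [hSe, coe_wedgeBasisD_blocksUnionPCD, mul_assoc, ← map_mul]

/-- **THE CORRESPONDENCE IN COORDINATES**: the model's map `contract (Q(·, y)) ∘ κ` of Lemma P step (2) is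
`ξ ↦ ∫_{B_N} (ξ ∧ pr_N^*(y ∧ Λ))` — the push-forward `pr_{M*}(ξ ∪ pr_N^*(y ∪ Λ_N))` on the wedge model. -/
theorem contract_kun_eq_fibInt {c : G} (hc : IsComplexConj c) {Φ₀ : Finset G} (hΦ : IsCMType c Φ₀) {n k : ℕ}
    (a : Fin k → G → ℂ) (y : Hn G k) (ξ : Hn G (n + k)) :
    LemmaP.contract ((Qc hc hΦ a).flip y) (kun n k ξ) =
      fibInt n k (topDeg Φ₀ k) ⟨(ξ : ExteriorAlgebra ℂ (V G (n + k))) * ExteriorAlgebra.map (inrMap n k)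
        ((y : ExteriorAlgebra ℂ (V G k)) * (Λc c Φ₀ a : ExteriorAlgebra ℂ (V G k))), mul_map_mul_Λc_mem a ξ y⟩ := by
  rw [← corrR_apply]
  exact LinearMap.congr_fun (Basis.ext (wedgeBasis (n + k)) (f₁ := LemmaP.contract ((Qc hc hΦ a).flip y) ∘ₗ kun n k)
    (f₂ := corrR c Φ₀ a y n) fun S => by
      rw [LinearMap.comp_apply]
      exact contract_kun_wedgeBasis_eq_corrR hc hΦ a y S) ξ

end Corr

end HodgeRepro.Night3.GSetModel
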